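import Literature.IUT.HodgeArakelov.EtaleLevelsSettingTemperedTokens
import Literature.AnabelianGeometry.SemiGraphs.TemperedCompletionKernel
import Literature.AnabelianGeometry.AbsoluteAnabelian.AbsTopIProp410GraphSurjectivityPrelims
import Literature.AnabelianGeometry.AbsoluteAnabelian.GaloisSubextensionProofs
import Literature.AnabelianGeometry.EtaleTheta.DoubleUnderlineTower
import HarnessLib

/-!
# The NAMED compatible MLF completion package of an [IUTchII] §1 setting, and (H1) «`Δ ⊆ Π` characteristic» at the
# genuine setting modulo FACT-LIST F-0001 AT THAT NAMED INSTANCE, with the `Δ`-tfg half of the regime DISCHARGED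

S. Mochizuki, *Inter-universal Teichmüller theory II*, §1, Example 1.8 (i) (kurims p. 35): "the subgroup `Δ ⊆ Π` [...]
may be characterized group-theoretically" [claim: Mochizuki2012, status: disputed]; [SemiAnbd] §6 p. 69 («the profinite
completion»), Ex. 3.10 p. 43 [cite: MochizukiSemiAnbd2006, §6 p.69]; [AbsTopI] Thm. 2.6 (v) p. 22
[cite: MochizukiAbsTopI2012, Thm 2.6 (v) p.22]; [AbsAnab] Lemma 1.1.4 (ii) p. 8 (FACT-LIST F-0001 `CoinvariantRankConstant`,
«admissible AT NAMED INSTANCES ONLY», R5) [cite: MochizukiAbsAnab2004, Lemma 1.1.4 (ii) p.8].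

Abc-iut cell, seat abc-iut-w5-d233 gen 4 (row «NAMED-COMPLETION-PACKAGE»).  Sequel of this lineage's
`ThetaSettingDeltaCharacteristicGenuine` (p429527), `AbsTopMonoidsGenuineOfSettingTempered` (p437556) and
`EtaleLevelsSettingTemperedTokens` (p439063).  Those files reduce (H1) at the genuine setting to the EXISTENCE of ONE compatible
MLF completion package `(E, B, ι, g)` «in the [AbsTopI] Thm 2.6 (v) regime», i.e. to an ∃-bound hypothesis
`∃ E B ι g, … ∧ IsTopologicallyFinitelyGenerated E.geom ∧ E.CoinvariantRankConstant` whose `E` is ANONYMOUS — so that the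
FACT-LIST fact F-0001, admissible only AT NAMED INSTANCES, could not literally be cited there.  THIS FILE names the package:

§1 (any [IUTchII] §1 setting `S` with an identification `eK : G_k ⥲ Gal(K̄/K)`, `K/ℚ_p` finite):
* `ThetaSetting.completionArith S` / `completionMap S` — THE profinite completion `ι : Π^{(S)} → Π_E` ([SemiAnbd] §6; choice
  from abc-iut-L2-d1's `exists_isProfiniteCompletion`), `isProfiniteCompletion_completionMap`;
* `ThetaSetting.completionAug S K eK` — the extension `Π_E ↠ Gal(K̄/K)` of `eK ∘ aug_S` along `ι` (universal property),
  `completionAug_completionMap`; **`ThetaSetting.completionPackage S K eK : FundamentalExtension`** with MLF base data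
  `completionPackageBase` (`(p, K, id)`); `deltaX_eq_comap_geom_completionPackage` (`Δ^{(S)} = ι⁻¹(Δ_E)`);
* `ThetaSetting.deltaX_characteristic_of_completionPackage` — **(H1) for `S` modulo EXACTLY two NAMED-instance hypotheses**:
  `IsTopologicallyFinitelyGenerated (completionPackage S K eK).geom` and `(completionPackage S K eK).CoinvariantRankConstant`
  (= F-0001 at the named instance);
* `ThetaSetting.geom_completionPackage_eq_topologicalClosure` — for OPEN `aug_S` (η′): **`Δ_E` IS the closure of `ι(Δ^{(S)})`**
  (right exactness of profinite completion, abc-iut-w4-d058's `IsProfiniteCompletion.ker_eq_topologicalClosure_map_ker`,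
  Ribes–Zalesskii Prop. 3.2.5 [cite: RibesZalesskii2010, Prop 3.2.5]); hence
  `isTopologicallyFinitelyGenerated_geom_completionPackage` — **the `Δ_E`-tfg half of the regime is a THEOREM of
  «`Δ^{(S)}` topologically finitely generated» + open `aug_S`**.
§2 (the GENUINE setting `ThetaSetting.ofDoubleUnderline` of the Tate curve `X̲̲_K`, `K := D.K`,
  `eK := TemperedCurve.galoisIdentification`):
* `isTopologicallyFinitelyGenerated_deltaX_ofDoubleUnderline` — `Δ^tp_{X̲̲} = Π^tp_{X̲̲} ∩ Δ^tp_X` is tfg as soon as `Δ^tp_X` is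
  (open subgroup of finite index `≤ l²`, abc-iut-L2's `index_Huu`; Schreier, `subgroup_isOpen_of_finiteIndex`);
* **`deltaX_characteristic_ofDoubleUnderline_of_named`** — (H1) AT THE GENUINE SETTING modulo {F-0001 AT THE NAMED INSTANCE
  `completionPackage (ofDoubleUnderline …) D.K galoisIdentification`, «`Π^tp_X` tempered + Galois-countable» (η′),
  «`Δ^tp_X` topologically finitely generated» ([SemiAnbd] Ex. 3.10 / [AbsTopI] Prop. 2.2: a property of the genuine tempered
  `π₁`, the «residue (c)» parameter of abc-iut-L4's Prop. 4.10 files)} — NO anonymous ∃, NO tfg clause on the package;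
  `AbsTopMonoids.exists_genuineIsm_ofDoubleUnderline_of_named` — the all-fields-genuine [IUTchII] Ex 1.8 producer there;
  `EtaleLevels.deltaX_characteristic_setting_of_named` — the same at abc-iut-w4-d030's `EtaleLevels.setting` (binder `hΔ` of
  the Cor. 1.11 / Cor. 1.12 (iii) genuine-chain theorems).

HONEST SCOPE: F-0001 `CoinvariantRankConstant` remains a FACT-LIST input BY NAME, now at a NAMED instance (the profinite
completion of the genuine `Π^tp_{X̲̲_K}` with its MLF base `(p, K)`), never discharged under campaign M; «tempered,
Galois-countable, `Δ^tp` tfg» are interface PARAMETERS of the genuine `Π^tp_X`; no curve / theta setting is asserted to exist;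
nothing here bears on [IUTchIII] Cor. 3.12; no side is taken; typed ≠ proved elsewhere.
-/

noncomputable section

namespace Literature.IUT.HodgeArakelov

open Literature.AnabelianGeometry.AbsoluteAnabelian
open Literature.AnabelianGeometry.SemiGraphs

namespace ThetaSetting

/-! ### §1. The named completion package of an [IUTchII] §1 setting -/

section Package

variable (S : ThetaSetting.{0})

/-- `Π_E`: THE profinite completion of `Π^{(S)} = Π^tp_{X̲̲_k}` ([SemiAnbd] §6 p. 69 "the profinite completion"), a choice
from abc-iut-L2-d1's existence theorem `IsProfiniteCompletion.exists_isProfiniteCompletion`.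
[cite: MochizukiSemiAnbd2006, §6 p.69] -/
def completionArith : ProfiniteGrp.{0} :=
  (IsProfiniteCompletion.exists_isProfiniteCompletion S.PiX).choose

/-- `ι : Π^{(S)} → Π_E`, the completion map. [cite: MochizukiSemiAnbd2006, §6 p.69] -/
def completionMap : S.PiX →ₜ* S.completionArith :=
  (IsProfiniteCompletion.exists_isProfiniteCompletion S.PiX).choose_spec.choose

/-- `ι : Π^{(S)} → Π_E` IS a profinite completion in the tree's interface sense. [cite: MochizukiSemiAnbd2006, §6 p.69] -/
theorem isProfiniteCompletion_completionMap : IsProfiniteCompletion S.completionMap :=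
  (IsProfiniteCompletion.exists_isProfiniteCompletion S.PiX).choose_spec.choose_spec

/-- The augmentation `aug_S : Π^{(S)} ↠ G_k` as a continuous homomorphism. [claim: Mochizuki2012, status: disputed]
(IUTchII §1 Ex 1.8 (i), kurims p.35) -/
def augCont : S.PiX →ₜ* S.Gk :=
  { toMonoidHom := S.aug, continuous_toFun := S.aug_continuous }

/-- `augCont` is `aug_S`. [claim: Mochizuki2012, status: disputed] (IUTchII §1 Ex 1.8 (i), kurims p.35) -/
@[simp] theorem augCont_apply (x : S.PiX) : S.augCont x = S.aug x := rfl

variable (K : Type) [Field K] [CharZero K] (eK : S.Gk ≃ₜ* Field.absoluteGaloisGroup K)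

/-- `eK ∘ aug_S : Π^{(S)} → Gal(K̄/K)` as a continuous homomorphism into the profinite `absoluteGaloisGrp K`.
[cite: MochizukiSemiAnbd2006, §6 p.69] -/
def augGal : S.PiX →ₜ* absoluteGaloisGrp K :=
  { toMonoidHom := eK.toMulEquiv.toMonoidHom.comp S.aug
    continuous_toFun := eK.continuous.comp S.aug_continuous }

/-- `augGal x = eK (aug_S x)`. [cite: MochizukiSemiAnbd2006, §6 p.69] -/
@[simp] theorem augGal_apply (x : S.PiX) : S.augGal K eK x = eK (S.aug x) := rfl

/-- `eK` itself as a continuous homomorphism `G_k → absoluteGaloisGrp K`. [cite: MochizukiSemiAnbd2006, §6 p.69] -/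
def galHom : S.Gk →ₜ* absoluteGaloisGrp K :=
  { toMonoidHom := eK.toMulEquiv.toMonoidHom, continuous_toFun := eK.continuous }

/-- `galHom σ = eK σ`. [cite: MochizukiSemiAnbd2006, §6 p.69] -/
@[simp] theorem galHom_apply (σ : S.Gk) : S.galHom K eK σ = eK σ := rfl

/-- `aug_E : Π_E ↠ Gal(K̄/K)`: THE extension of `eK ∘ aug_S` along the completion `ι` (universal property of the profinite
completion, `IsProfiniteCompletion.exists_extension`; a choice — the extension is unique by density, not needed here).
[cite: MochizukiSemiAnbd2006, §6 p.69] -/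
def completionAug : S.completionArith →ₜ* absoluteGaloisGrp K :=
  (IsProfiniteCompletion.exists_extension S.isProfiniteCompletion_completionMap (S.augGal K eK)).choose

/-- `aug_E ∘ ι = eK ∘ aug_S`. [cite: MochizukiSemiAnbd2006, §6 p.69] -/
theorem completionAug_completionMap (x : S.PiX) : S.completionAug K eK (S.completionMap x) = eK (S.aug x) :=
  (IsProfiniteCompletion.exists_extension S.isProfiniteCompletion_completionMap (S.augGal K eK)).choose_spec x

/-- `aug_E` is surjective (`aug_S` and `eK` are). [cite: MochizukiSemiAnbd2006, §6 p.69] -/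
theorem completionAug_surjective : Function.Surjective (S.completionAug K eK) := by
  intro y
  obtain ⟨x, hx⟩ := S.aug_surjective (eK.symm y)
  refine ⟨S.completionMap x, ?_⟩
  rw [completionAug_completionMap, hx, ContinuousMulEquiv.apply_symm_apply]

/-- **THE NAMED compatible MLF completion package of `S`**: `Π_E :=` the profinite completion of `Π^{(S)}`,
`G_E := Gal(K̄/K)`, `aug_E :=` the extension of `eK ∘ aug_S` — an extension of profinite groups `1 → Δ_E → Π_E → G_E → 1` in
the sense of [AbsTopIII] Thm 1.9 / abc-iut-L4's `FundamentalExtension`. [cite: MochizukiSemiAnbd2006, §6 p.69] -/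
abbrev completionPackage : FundamentalExtension.{0} where
  arith := S.completionArith
  gal := absoluteGaloisGrp K
  aug := S.completionAug K eK
  aug_surjective := S.completionAug_surjective K eK

/-- Its MLF base data `(p, K, id)` ([AbsAnab] §1.3 "defined over a finite extension `K` of `ℚ_p`").
[cite: MochizukiAbsAnab2004, §1.3 p.18] -/
def completionPackageBase (p : ℕ) [Fact p.Prime] [Algebra ℚ_[p] K] [FiniteDimensional ℚ_[p] K] :
    (S.completionPackage K eK).MLFBase where
  p := p
  K := K
  galIso := ContinuousMulEquiv.refl _

/-- The package's augmentation is compatible with `aug_S` through the INJECTIVE `eK`: `aug_E (ι x) = eK (aug_S x)`.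
[cite: MochizukiSemiAnbd2006, §6 p.69] -/
theorem completionPackage_compat (x : S.PiX) :
    (S.completionPackage K eK).aug (S.completionMap x) = (S.galHom K eK).toMonoidHom (S.aug x) :=
  S.completionAug_completionMap K eK x

/-- `eK` is injective (bookkeeping for the compatible-package shape of p429527). [cite: MochizukiSemiAnbd2006, §6 p.69] -/
theorem galHom_injective : Function.Injective (S.galHom K eK).toMonoidHom := fun _ _ h => eK.injective h

/-- **`Δ^{(S)} = ι⁻¹(Δ_E)`** for the named package (p429527's `deltaX_eq_comap_of_aug_compatible`).
[cite: MochizukiSemiAnbd2006, §6 p.69] -/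
theorem deltaX_eq_comap_geom_completionPackage :
    S.DeltaX = (S.completionPackage K eK).geom.comap S.completionMap.toMonoidHom :=
  deltaX_eq_comap_of_aug_compatible S (S.completionPackage K eK) S.completionMap (S.galHom K eK).toMonoidHom
    (S.galHom_injective K eK) (S.completionPackage_compat K eK)

/-- The named package realises the ∃-bound «compatible completion package» hypothesis shape of p429527 / p433775 / p437556 /
p439063 as soon as its two regime clauses are supplied. [cite: MochizukiAbsTopI2012, Thm 2.6 (v) p.22] -/
theorem exists_package_of_named (p : ℕ) [Fact p.Prime] [Algebra ℚ_[p] K] [FiniteDimensional ℚ_[p] K]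
    (htfg : IsTopologicallyFinitelyGenerated (S.completionPackage K eK).geom)
    (hcrc : (S.completionPackage K eK).CoinvariantRankConstant) :
    ∃ (E : FundamentalExtension.{0}) (_ : E.MLFBase) (ι : S.PiX →ₜ* E.arith) (g : S.Gk →* E.gal),
      IsProfiniteCompletion ι ∧ Function.Injective g ∧ (∀ x, E.aug (ι x) = g (S.aug x)) ∧
        IsTopologicallyFinitelyGenerated E.geom ∧ E.CoinvariantRankConstant :=
  ⟨S.completionPackage K eK, S.completionPackageBase K eK p, S.completionMap, (S.galHom K eK).toMonoidHom,
    S.isProfiniteCompletion_completionMap, S.galHom_injective K eK, S.completionPackage_compat K eK, htfg, hcrc⟩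

/-- **(H1) «`Δ^{(S)} ⊆ Π^{(S)}` is characteristic» modulo EXACTLY two NAMED-instance hypotheses on THE package**: `Δ_E`
topologically finitely generated and `CoinvariantRankConstant` (FACT-LIST F-0001 at the named instance
`completionPackage S K eK`) — [AbsTopI] Thm 2.6 (v) through p427416/p429527's tempered reduction.
[claim: Mochizuki2012, status: disputed] (IUTchII §1 Ex 1.8 (i), kurims p.35) [cite: MochizukiAbsTopI2012, Thm 2.6 (v) p.22] -/
theorem deltaX_characteristic_of_completionPackage (p : ℕ) [Fact p.Prime] [Algebra ℚ_[p] K]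
    [FiniteDimensional ℚ_[p] K]
    (htfg : IsTopologicallyFinitelyGenerated (S.completionPackage K eK).geom)
    (hcrc : (S.completionPackage K eK).CoinvariantRankConstant) :
    ∀ f : S.PiX ≃ₜ* S.PiX, S.DeltaX.map f.toMulEquiv.toMonoidHom = S.DeltaX :=
  fun f => deltaX_map_eq_of_completion_compatible_coinvariantRankConstant S (S.completionPackage K eK)
    (S.completionPackageBase K eK p) htfg hcrc S.completionMap S.isProfiniteCompletion_completionMap
    (S.galHom K eK).toMonoidHom (S.galHom_injective K eK) (S.completionPackage_compat K eK) f

/-! ### `Δ_E` is the closure of `ι(Δ^{(S)})` (open `aug_S`), hence tfg if `Δ^{(S)}` is -/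

/-- `eK : G_k ⥲ Gal(K̄/K)`, read as a continuous homomorphism onto a profinite group, is a profinite completion of `G_k`
(trivially: a bicontinuous isomorphism onto a compact Hausdorff totally disconnected group).
[cite: MochizukiSemiAnbd2006, §6 p.69] -/
theorem isProfiniteCompletion_galHom : IsProfiniteCompletion (S.galHom K eK) where
  compactSpace := inferInstance
  t2Space := inferInstance
  totallyDisconnectedSpace := inferInstance
  denseRange := eK.surjective.denseRange
  comap_surjective U _ := by
    haveI : U.toSubgroup.Normal := U.isNormal'
    refine ⟨⟨⟨U.toSubgroup.map (S.galHom K eK).toMonoidHom, ?_⟩, ?_⟩, ?_⟩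
    · change IsOpen ((S.galHom K eK) '' (U : Set S.Gk))
      exact eK.toHomeomorph.isOpenMap _ U.isOpen'
    · exact Subgroup.Normal.map U.isNormal' _ eK.surjective
    · exact (Subgroup.comap_map_eq_self_of_injective (S.galHom_injective K eK) _).symm
  isOpen_comap V := V.isOpen'.preimage eK.continuous

/-- **`Δ_E = ` the closure of `ι(Δ^{(S)})` in `Π_E`** when `aug_S` is an OPEN map (η′: open mapping theorem for tempered groups,
p437556): right exactness of profinite completion (abc-iut-w4-d058's `IsProfiniteCompletion.ker_eq_topologicalClosure_map_ker`
for the square `aug_E ∘ ι = eK ∘ aug_S`). [cite: RibesZalesskii2010, Prop 3.2.5] [cite: MochizukiSemiAnbd2006, §6 p.69] -/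
theorem geom_completionPackage_eq_topologicalClosure (hopen : IsOpenMap S.aug) :
    (S.completionPackage K eK).geom = (S.DeltaX.map S.completionMap.toMonoidHom).topologicalClosure :=
  IsProfiniteCompletion.ker_eq_topologicalClosure_map_ker S.isProfiniteCompletion_completionMap
    (S.isProfiniteCompletion_galHom K eK) S.augCont S.aug_surjective hopen (S.completionAug K eK)
    (S.completionAug_completionMap K eK)

/-- `ι` carries `Δ^{(S)}` into `Δ_E`. [cite: MochizukiSemiAnbd2006, §6 p.69] -/
theorem completionMap_mem_geom {x : S.PiX} (hx : x ∈ S.DeltaX) :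
    S.completionMap x ∈ (S.completionPackage K eK).geom := by
  rw [S.deltaX_eq_comap_geom_completionPackage K eK] at hx
  exact hx

/-- The corestriction `ι|_Δ : Δ^{(S)} → Δ_E`. [cite: MochizukiSemiAnbd2006, §6 p.69] -/
def deltaCompletionMap : S.DeltaX →ₜ* (S.completionPackage K eK).geom where
  toFun x := ⟨S.completionMap x, S.completionMap_mem_geom K eK x.2⟩
  map_one' := Subtype.ext (by simp only [OneMemClass.coe_one, map_one])
  map_mul' a b := Subtype.ext (by simp only [Subgroup.coe_mul, map_mul])
  continuous_toFun := (S.completionMap.continuous.comp continuous_subtype_val).subtype_mk _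

/-- `ι|_Δ` followed by the inclusion is `ι`. [cite: MochizukiSemiAnbd2006, §6 p.69] -/
@[simp] theorem coe_deltaCompletionMap_apply (x : S.DeltaX) :
    (S.deltaCompletionMap K eK x).1 = S.completionMap x := rfl

/-- For open `aug_S`, `ι|_Δ : Δ^{(S)} → Δ_E` has DENSE range (`Δ_E` is the closure of `ι(Δ^{(S)})`).
[cite: MochizukiSemiAnbd2006, §6 p.69] -/
theorem denseRange_deltaCompletionMap (hopen : IsOpenMap S.aug) : DenseRange (S.deltaCompletionMap K eK) := by
  rintro ⟨z, hz⟩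
  rw [closure_subtype]
  rw [S.geom_completionPackage_eq_topologicalClosure K eK hopen, ← SetLike.mem_coe, Subgroup.topologicalClosure_coe,
    Subgroup.coe_map] at hz
  refine closure_mono ?_ hz
  rintro _ ⟨x, hx, rfl⟩
  exact ⟨S.deltaCompletionMap K eK ⟨x, hx⟩, ⟨⟨x, hx⟩, rfl⟩, rfl⟩

/-- **The `Δ_E`-tfg half of the [AbsTopI] Thm 2.6 (v) regime is a THEOREM for the named package**: if `aug_S` is open (η′)
and `Δ^{(S)}` is topologically finitely generated, so is `Δ_E` (image of a dense finitely generated subgroup under the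
dense-range `ι|_Δ`). [cite: MochizukiAbsTopI2012, §0 p.8] [cite: MochizukiSemiAnbd2006, §6 p.69] -/
theorem isTopologicallyFinitelyGenerated_geom_completionPackage (hopen : IsOpenMap S.aug)
    (hΔ : IsTopologicallyFinitelyGenerated S.DeltaX) :
    IsTopologicallyFinitelyGenerated (S.completionPackage K eK).geom :=
  hΔ.of_denseRange (S.deltaCompletionMap K eK) (S.denseRange_deltaCompletionMap K eK hopen)

/-- **(H1) for `S` from {open `aug_S`, `Δ^{(S)}` tfg, F-0001 at the named package}.**
[claim: Mochizuki2012, status: disputed] (IUTchII §1 Ex 1.8 (i), kurims p.35) [cite: MochizukiAbsTopI2012, Thm 2.6 (v) p.22] -/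
theorem deltaX_characteristic_of_named (p : ℕ) [Fact p.Prime] [Algebra ℚ_[p] K] [FiniteDimensional ℚ_[p] K]
    (hopen : IsOpenMap S.aug) (hΔ : IsTopologicallyFinitelyGenerated S.DeltaX)
    (hcrc : (S.completionPackage K eK).CoinvariantRankConstant) :
    ∀ f : S.PiX ≃ₜ* S.PiX, S.DeltaX.map f.toMulEquiv.toMonoidHom = S.DeltaX :=
  S.deltaX_characteristic_of_completionPackage K eK p
    (S.isTopologicallyFinitelyGenerated_geom_completionPackage K eK hopen hΔ) hcrc

end Package

/-! ### §2. The genuine [IUTchII] §1 setting of the Tate curve `X̲̲_K` -/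

section Genuine

open Literature.AnabelianGeometry.EtaleTheta
open scoped Literature.AnabelianGeometry.EtaleTheta

variable {p : ℕ} [Fact p.Prime] {D : Literature.AnabelianGeometry.EtaleTheta.ThetaSetting p}
  {ED : D.EtaleThetaData} {l : ℕ} (C : ED.DoubleUnderline l) {N : ℕ+} (μ : D.CyclotomeMod l N)
  (hC : D.Compat) (hS : D.Sec2Hyps) (hl : l.Prime) (hp2 : p ≠ 2) (hpl : p ≠ l)
  (hζ : ∃ ζ : D.K, IsPrimitiveRoot ζ (4 * l)) {η : (C.thetaEnvData μ hC hS).PiYdd → MuN p N}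
  (hη : η ∈ (C.thetaEnvData μ hC hS).thetaCocycles)

/-- At the genuine setting, `h ∈ Δ^tp_{X̲̲}` iff `h ∈ Δ^tp_X` (`Δ^tp_{X̲̲} = Π^tp_{X̲̲} ∩ Δ^tp_X`).
[cite: MochizukiEtTh2009, Prop 2.2 (iii) p.37] -/
theorem mem_deltaX_ofDoubleUnderline_iff (h : (ofDoubleUnderline C μ hC hS hl hp2 hpl hζ hη).PiX) :
    h ∈ (ofDoubleUnderline C μ hC hS hl hp2 hpl hζ hη).DeltaX ↔ ((show C.Huu from h) : D.PiTemp) ∈ D.DeltaTemp :=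
  MonoidHom.mem_ker.trans (Subtype.ext_iff.trans Iff.rfl)

/-- `Δ^tp_{X̲̲} ≅ Π^tp_{X̲̲} ∩ Δ^tp_X` (read inside `Δ^tp_X`) as TOPOLOGICAL groups — the same subset of `Π^tp_X` with the subspace
topology. [cite: MochizukiEtTh2009, Prop 2.2 (iii) p.37] -/
def deltaXEquivSubgroupOf :
    ↥(C.Huu.subgroupOf D.DeltaTemp) ≃ₜ* ↥(ofDoubleUnderline C μ hC hS hl hp2 hpl hζ hη).DeltaX where
  toFun x := ⟨show (ofDoubleUnderline C μ hC hS hl hp2 hpl hζ hη).PiX from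
      (⟨((x : D.DeltaTemp) : D.PiTemp), Subgroup.mem_subgroupOf.1 x.2⟩ : C.Huu),
    (mem_deltaX_ofDoubleUnderline_iff C μ hC hS hl hp2 hpl hζ hη _).2 (x : D.DeltaTemp).2⟩
  invFun y := ⟨⟨((show C.Huu from y.1) : D.PiTemp),
      (mem_deltaX_ofDoubleUnderline_iff C μ hC hS hl hp2 hpl hζ hη y.1).1 y.2⟩,
    Subgroup.mem_subgroupOf.2 (show C.Huu from y.1).2⟩
  left_inv x := rfl
  right_inv y := rfl
  map_mul' a b := rfl
  continuous_toFun := by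
    apply Continuous.subtype_mk
    apply Continuous.subtype_mk
    exact continuous_subtype_val.comp continuous_subtype_val
  continuous_invFun := by
    apply Continuous.subtype_mk
    apply Continuous.subtype_mk
    exact continuous_subtype_val.comp continuous_subtype_val

/-- **`Δ^tp_{X̲̲}` is topologically finitely generated as soon as `Δ^tp_X` is**: `Π^tp_{X̲̲} ∩ Δ^tp_X` is an OPEN subgroup of
`Δ^tp_X` of FINITE index (`[Π^tp_X : Π^tp_{X̲̲}] = l²`, abc-iut-L2's `index_Huu`), so Schreier's lemma applies
(`IsTopologicallyFinitelyGenerated.subgroup_isOpen_of_finiteIndex`). [cite: MochizukiAbsTopI2012, §0 p.8]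
[cite: MochizukiEtTh2009, Rmk 2.3.1 p.38] -/
theorem isTopologicallyFinitelyGenerated_deltaX_ofDoubleUnderline (hΔ : IsTopologicallyFinitelyGenerated D.DeltaTemp) :
    IsTopologicallyFinitelyGenerated (ofDoubleUnderline C μ hC hS hl hp2 hpl hζ hη).DeltaX := by
  haveI : C.Huu.FiniteIndex :=
    Subgroup.finiteIndex_iff.2 (by rw [C.index_Huu]; exact pow_ne_zero _ C.l_ne_zero)
  have hopen : IsOpen ((C.Huu.subgroupOf D.DeltaTemp : Subgroup D.DeltaTemp) : Set D.DeltaTemp) :=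
    C.isOpen_Huu.preimage continuous_subtype_val
  exact (hΔ.subgroup_isOpen_of_finiteIndex _ hopen).of_continuousMulEquiv
    (deltaXEquivSubgroupOf C μ hC hS hl hp2 hpl hζ hη)

/-- The named completion package of the genuine setting, with base `(p, K)` and `eK :=` abc-iut-L3's `galoisIdentification`
`G_K ⥲ Gal(K̄_K/K)` — THE instance at which F-0001 is consumed below. [cite: MochizukiSemiAnbd2006, §6 p.69] -/
theorem isTopologicallyFinitelyGenerated_geom_completionPackage_ofDoubleUnderline (hT : IsTempered D.PiTemp)
    [FirstCountableTopology D.PiTemp] (hΔ : IsTopologicallyFinitelyGenerated D.DeltaTemp) :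
    IsTopologicallyFinitelyGenerated
      ((ofDoubleUnderline C μ hC hS hl hp2 hpl hζ hη).completionPackage D.K D.toTemperedCurve.galoisIdentification).geom :=
  isTopologicallyFinitelyGenerated_geom_completionPackage (ofDoubleUnderline C μ hC hS hl hp2 hpl hζ hη) D.K
    D.toTemperedCurve.galoisIdentification
    (isOpenMap_aug_ofDoubleUnderline_of_isTempered C μ hC hS hl hp2 hpl hζ hη hT)
    (isTopologicallyFinitelyGenerated_deltaX_ofDoubleUnderline C μ hC hS hl hp2 hpl hζ hη hΔ)

/-- **(H1) AT THE GENUINE SETTING modulo F-0001 AT THE NAMED INSTANCE**: for tempered Galois-countable `Π^tp_X` with `Δ^tp_X`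
topologically finitely generated, `CoinvariantRankConstant` of THE completion package of `Π^tp_{X̲̲_K}` (FACT-LIST F-0001 at that
named instance, [AbsAnab] Lemma 1.1.4 (ii) p. 8) implies that every automorphism of topological groups of `Π^tp_{X̲̲}` carries
`Δ^tp_{X̲̲}` onto itself. [claim: Mochizuki2012, status: disputed] (IUTchII §1 Ex 1.8 (i), kurims p.35)
[cite: MochizukiAbsTopI2012, Thm 2.6 (v) p.22] [cite: MochizukiAbsAnab2004, Lemma 1.1.4 (ii) p.8] -/
theorem deltaX_characteristic_ofDoubleUnderline_of_named (hT : IsTempered D.PiTemp) [FirstCountableTopology D.PiTemp]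
    (hΔ : IsTopologicallyFinitelyGenerated D.DeltaTemp)
    (hcrc : ((ofDoubleUnderline C μ hC hS hl hp2 hpl hζ hη).completionPackage D.K
        D.toTemperedCurve.galoisIdentification).CoinvariantRankConstant) :
    ∀ f : (ofDoubleUnderline C μ hC hS hl hp2 hpl hζ hη).PiX ≃ₜ* (ofDoubleUnderline C μ hC hS hl hp2 hpl hζ hη).PiX,
      (ofDoubleUnderline C μ hC hS hl hp2 hpl hζ hη).DeltaX.map f.toMulEquiv.toMonoidHom =
        (ofDoubleUnderline C μ hC hS hl hp2 hpl hζ hη).DeltaX := by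
  haveI : FiniteDimensional ℚ_[p] D.K := D.finiteDimensional_K
  exact deltaX_characteristic_of_named (ofDoubleUnderline C μ hC hS hl hp2 hpl hζ hη) D.K
    D.toTemperedCurve.galoisIdentification p
    (isOpenMap_aug_ofDoubleUnderline_of_isTempered C μ hC hS hl hp2 hpl hζ hη hT)
    (isTopologicallyFinitelyGenerated_deltaX_ofDoubleUnderline C μ hC hS hl hp2 hpl hζ hη hΔ) hcrc

/-- **The ALL-FIELDS-GENUINE [IUTchII] Ex 1.8 producer at the genuine setting modulo {η′ (+ `Δ^tp_X` tfg), F-0001 at the named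
instance}** — ∃-form with monoid `𝒪^⊳_{K̄_K}` and `Ism(G)` = print's isometry group (p434943's producer, both binders supplied
BY NAME, no anonymous package). [claim: Mochizuki2012, status: disputed] (IUTchII §1 Ex 1.8 (iv), kurims p.39) -/
theorem _root_.Literature.IUT.HodgeArakelov.AbsTopMonoids.exists_genuineIsm_ofDoubleUnderline_of_named
    (hT : IsTempered D.PiTemp) [FirstCountableTopology D.PiTemp] (hΔ : IsTopologicallyFinitelyGenerated D.DeltaTemp)
    (hcrc : ((ofDoubleUnderline C μ hC hS hl hp2 hpl hζ hη).completionPackage D.K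
        D.toTemperedCurve.galoisIdentification).CoinvariantRankConstant) :
    ∃ A : AbsTopMonoids (ofDoubleUnderline C μ hC hS hl hp2 hpl hζ hη),
      (∀ G, A.Otri G =
        (ModelMLFGaloisData.galois D.toTemperedCurve.mlfClosure.k D.toTemperedCurve.mlfClosure.K).tmPair.M) ∧
      ∀ G, A.Ism G = ↥((AbsTopMonoids.genuineOfModel (ofDoubleUnderline C μ hC hS hl hp2 hpl hζ hη)
          D.toTemperedCurve.mlfClosure D.toTemperedCurve.galoisEpsilon
          (deltaX_characteristic_ofDoubleUnderline_of_named C μ hC hS hl hp2 hpl hζ hη hT hΔ hcrc)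
          (quotDeltaX_iso_ofDoubleUnderline_of_isTempered C μ hC hS hl hp2 hpl hζ hη hT)).ism G) :=
  ⟨AbsTopMonoids.genuineOfDoubleUnderlineIsm C μ hC hS hl hp2 hpl hζ hη
      (deltaX_characteristic_ofDoubleUnderline_of_named C μ hC hS hl hp2 hpl hζ hη hT hΔ hcrc)
      (quotDeltaX_iso_ofDoubleUnderline_of_isTempered C μ hC hS hl hp2 hpl hζ hη hT),
    fun _ => rfl, fun _ => rfl⟩

end Genuine

end ThetaSetting

/-! ### §3. At abc-iut-w4-d030's `EtaleLevels.setting` (binder `hΔ` of the Cor. 1.11 / Cor. 1.12 (iii) theorems) -/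

namespace EtaleLevels

open Literature.AnabelianGeometry.EtaleTheta
open scoped Literature.AnabelianGeometry.EtaleTheta

variable {p : ℕ} [Fact p.Prime] {D : Literature.AnabelianGeometry.EtaleTheta.ThetaSetting p}
  {E : D.EtaleThetaData} {l : ℕ} (C : E.DoubleUnderline l) (hC : D.Compat) (hS : D.Sec2Hyps)
  (hl : l.Prime) (hp2 : p ≠ 2) (hpl : p ≠ l) (hζ : ∃ ζ : D.K, IsPrimitiveRoot ζ (4 * l))
  (mods : ∀ M : ℕ+, D.CyclotomeMod l M)
  (f : contCocycles D.toTheta D.DeltaTheta C.GtpYdduu) (hf : f ∈ C.rootCocycles hC)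

/-- **(H1) at `EtaleLevels.setting` modulo F-0001 at the NAMED instance** `completionPackage (setting …) D.K galoisIdentification`,
for tempered Galois-countable `Π^tp_X` with `Δ^tp_X` tfg — the binder `hΔ` of p431925 / p433665 / p434854 / p434852 supplied
BY NAME with no anonymous package. [claim: Mochizuki2012, status: disputed] (IUTchII §1 Ex 1.8 (i), kurims p.35) -/
theorem deltaX_characteristic_setting_of_named (hT : IsTempered D.PiTemp) [FirstCountableTopology D.PiTemp]
    (hΔ : IsTopologicallyFinitelyGenerated D.DeltaTemp)
    (hcrc : ((setting C hC hS hl hp2 hpl hζ mods f hf).completionPackage D.K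
        D.toTemperedCurve.galoisIdentification).CoinvariantRankConstant) :
    ∀ φ : (setting C hC hS hl hp2 hpl hζ mods f hf).PiX ≃ₜ* (setting C hC hS hl hp2 hpl hζ mods f hf).PiX,
      (setting C hC hS hl hp2 hpl hζ mods f hf).DeltaX.map φ.toMulEquiv.toMonoidHom =
        (setting C hC hS hl hp2 hpl hζ mods f hf).DeltaX :=
  ThetaSetting.deltaX_characteristic_ofDoubleUnderline_of_named C (mods 1) hC hS hl hp2 hpl hζ
    (eta0_mem C hC hS mods f hf 1) hT hΔ hcrc

end EtaleLevels

end Literature.IUT.HodgeArakelov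

end
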